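import Summits.BirchSwinnertonDyer.BirchSwinnertonDyer.Theorems.CycTangentCMCycTangentBoundFrameSignCharacters
import Summits.BirchSwinnertonDyer.BirchSwinnertonDyer.Theorems.CycTangentCMCycTangentBoundFrameSignRoots
import Literature.NumberTheory.EllipticCurves.DeShalit1987.KatzMeasureMonomialLines
import HarnessLib

set_option linter.dupNamespace false
set_option autoImplicit false

/-!
# Crux `CycTangentCM.CycTangentBound` (stmt-BirchSwinnertonDyer-22628), line `tangent-cone-parity`,
# stub `stub_frameSign`, PARITY HALF: the sign of a self-dual pointwise functional equation on the
# frame is `(−1)^{λ̄}`, `λ̄` the order of the reduced cyclotomic line (all PROVED)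

Route `CycTangentCM` (D-0145 line of ideator bsd-idea-2; K6 leaf `BSDpOnClassX9`); seat
`bsd-line-ctcm-p2`.  By the normal form (`CycTangentCMCycTangentBoundFrameSignNormalForm`),
`stub_frameSign` ⟺ «odd tangency», and the number theory owed is a sign `w = ±1` with
(i) `w = (−1)^{ord ḡ}` for the reduced inner line `ḡ ≠ 0` and (ii) `w = −1 ∧ c̄₀₀ = c̄₀₁ = 0 ⟹ c̄₁₀ = 0`.
Both are to be read off a SELF-DUAL POINTWISE RELATION on `G ∈ 𝒪_{ℂ_p}⟦T₁⟧⟦T₂⟧`: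

  `(SD)  ∀ r r₂ through (κ₁, κ₂), IsConjInverse r r₂ → G(P(r₂)) = x → G(P(r)) = w · r(g) · x`,

`P(r) = (r(γ₁) − 1, r(γ₂) − 1)` — the shape in which de Shalit's functional equation II.6.4 (9)/(15) is
typed (`DeShalit1987.thmII64_katzMeasure₂_functionalEquation`, there with a second frame `Ǧ` and a
unit `C`; on the self-dual branch `(ψ_A⁻¹)̌ = ψ_A⁻¹` of a CM curve over `ℚ`, `Ǧ = G` and
`C = sgn(ψ_A⁻¹) = ±1`, II.6.5 (18)).  THIS FILE proves (i) from (SD), frame-free: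

* §1 `norm_value_sub_coeff_mul_pow_le` — ultrametric reading of a value (terms bounded by the
  tree's `IntSeries.norm_coeff_mul_pow_le_one`): for `Q ∈ 𝒪_{ℂ_p}⟦T⟧`,
  `‖x‖ < 1`, `‖Q(x) − [T^λ]Q · x^λ‖ ≤ max B ‖x‖^{λ+1}` whenever `‖[T^n]Q‖ ≤ B` for `n < λ`;
  `exists_hasValueAt` (values exist on the open disc).
* §2 `sign_mul_neg_one_pow_order_eq_one_of_selfDual` — (SD) with `w = ±1`, a generator pair
  `(κ₁, κ₂; γ₁, γ₂)` with `κ₂` CYCLOTOMIC, and `ḡ ≠ 0` of order `λ` force `w · (−1)^λ = 1`: evaluate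
  (SD) at the cyclotomic pair `(ψ_ζ, ψ_ζ⁻¹)` (`ψ_ζ = ζ^{κ₂ mod p^N}`, partner `ψ_ζ⁻¹` by
  `isConjInverse_unitsChar_inv_of_isCyclotomic`), i.e. at the points `(0, ζ − 1)`, `(0, ζ⁻¹ − 1)` of
  the inner line, with `‖ζ − 1‖^λ` larger than every non-unit coefficient below `λ`
  (`exists_rootOfUnity_norm_sub_one_gt`): the leading terms give `‖1 − w(−1)^λ η‖ < 1` for a
  `p`-power root of unity `η`, impossible for `w(−1)^λ = −1` as `‖2‖ = 1` (`p` odd).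
  Corollary `sign_eq_neg_one_pow_order_of_selfDual`: `w = (−1)^{ord ḡ}`.

THEOREMS ONLY (no definition, no named fact, no `sorry`); nothing about any curve or measure is
asserted: (SD) is a HYPOTHESIS.  Supports, does not close, stmt-BirchSwinnertonDyer-22628.

References: [deShalit1987] II.6.4 (9), (13)–(15), II.6.5 (18) (p. 84–86); [MazurTateTeitelbaum1986Invent]
§I.17–18 (sign of the functional equation vs. order of vanishing); [Gouvea1993PadicNumbers] §5.7.
-/

noncomputable section

open scoped Classical Topology
open Filter NumberField Field PowerSeries Literature.NumberTheory.EllipticCurves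
  Literature.NumberTheory.GaloisRepresentations
  Summit.BirchSwinnertonDyer.Rank1Residual.X11b.Three.LambdaSupply
  Summit.BirchSwinnertonDyer.BirchSwinnertonDyer.Theorems.CycTangentCMCycTangentBoundFrameSignCharacters
  Summit.BirchSwinnertonDyer.BirchSwinnertonDyer.Theorems.CycTangentCMCycTangentBoundFrameSignRoots

namespace Summit.BirchSwinnertonDyer.BirchSwinnertonDyer.Theorems.CycTangentCMCycTangentBoundFrameSignParity

variable {p : ℕ} [hp : Fact p.Prime]

/-! ## §1 Ultrametric reading of a value of `Q ∈ 𝒪_{ℂ_p}⟦T⟧` -/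

/-- Values exist on the open unit disc. [folklore] -/
theorem exists_hasValueAt (Q : PowerSeries (PadicComplexInt p)) {x : ℂ_[p]} (hx : ‖x‖ < 1) :
    ∃ v : ℂ_[p], IntSeries.HasValueAt Q x v :=
  ⟨_, ((summable_geometric_of_lt_one (norm_nonneg x) hx).of_norm_bounded
    (IntSeries.norm_coeff_mul_pow_le_one Q x)).hasSum⟩

/-- **Leading-term reading of a value.**  If `‖[T^n]Q‖ ≤ B` for all `n < m` (`0 ≤ B`) and `‖x‖ < 1`,
then `‖Q(x) − [T^m]Q · x^m‖ ≤ max B ‖x‖^{m+1}`: the terms below `m` have norm `≤ B`, those above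
have norm `≤ ‖x‖^{m+1}`. [folklore] -/
theorem norm_value_sub_coeff_mul_pow_le {Q : PowerSeries (PadicComplexInt p)} {x v : ℂ_[p]}
    (hx : ‖x‖ < 1) (hv : IntSeries.HasValueAt Q x v) (m : ℕ) {B : ℝ} (hB : 0 ≤ B)
    (hQ : ∀ n < m, ‖((PowerSeries.coeff n Q : PadicComplexInt p) : ℂ_[p])‖ ≤ B) :
    ‖v - ((PowerSeries.coeff m Q : PadicComplexInt p) : ℂ_[p]) * x ^ m‖ ≤ max B (‖x‖ ^ (m + 1)) := by
  set f : ℕ → ℂ_[p] := fun n => ((PowerSeries.coeff n Q : PadicComplexInt p) : ℂ_[p]) * x ^ n with hf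
  have hfv : HasSum f v := hv
  have hsub : HasSum (fun n => f n - if n = m then f m else 0) (v - f m) :=
    hfv.sub (hasSum_ite_eq m (f m))
  rw [show ((PowerSeries.coeff m Q : PadicComplexInt p) : ℂ_[p]) * x ^ m = f m from rfl, ← hsub.tsum_eq]
  refine IsUltrametricDist.norm_tsum_le_of_forall_le_of_nonneg (le_max_of_le_left hB) fun n => ?_
  by_cases hn : n = m
  · subst hn; simp [le_max_of_le_left hB]
  · rw [if_neg hn, sub_zero]
    rcases Nat.lt_or_gt_of_ne hn with hlt | hgt
    · refine le_max_of_le_left ?_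
      calc ‖f n‖ ≤ ‖((PowerSeries.coeff n Q : PadicComplexInt p) : ℂ_[p])‖ * 1 := by
            rw [hf, norm_mul, norm_pow]
            exact mul_le_mul_of_nonneg_left (pow_le_one₀ (norm_nonneg _) hx.le) (norm_nonneg _)
        _ ≤ B := by rw [mul_one]; exact hQ n hlt
    · refine le_max_of_le_right ((IntSeries.norm_coeff_mul_pow_le_one Q x n).trans ?_)
      exact pow_le_pow_of_le_one (norm_nonneg _) hx.le hgt

/-! ## §2 The parity of the sign -/

/-- `‖2‖ = 1` in `ℂ_p` for odd `p`. [folklore] -/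
theorem norm_two_eq_one (hp2 : p ≠ 2) : ‖(2 : ℂ_[p])‖ = 1 := by
  have h2 : ‖((2 : ℤ) : ℚ_[p])‖ = 1 := by
    refine le_antisymm (Padic.norm_int_le_one 2) (le_of_not_gt fun hlt => ?_)
    rw [Padic.norm_intCast_lt_one_iff] at hlt
    have : p ∣ 2 := by exact_mod_cast hlt
    exact hp2 ((Nat.prime_dvd_prime_iff_eq hp.out Nat.prime_two).mp this)
  have e : (((algebraMap ℚ_[p] (PadicAlgCl p) ((2 : ℤ) : ℚ_[p]) : PadicAlgCl p)) : ℂ_[p]) = 2 := by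
    rw [map_intCast, PadicComplex.coe_eq, map_intCast]; norm_num
  rw [← e, PadicComplex.norm_extends']
  exact h2

variable {K : Type} [Field K] [NumberField K]

/-- **The sign of a self-dual pointwise functional equation is `(−1)^{λ̄}`** (`λ̄` = order of the reduced
inner line).  Let `(κ₁, κ₂; γ₁, γ₂)` be a generator pair with `κ₂` CYCLOTOMIC, `p` odd,
`G ∈ 𝒪_{ℂ_p}⟦T₁⟧⟦T₂⟧`, `w = ±1`, `g ∈ Γ_K`, and suppose the self-dual relation (SD): for all
conjugate-inverse pairs `(r, r₂)` of characters through the pair, `G(P(r)) = w·r(g)·G(P(r₂))`.  If the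
reduction `ḡ` of `G(0, T₂)` is non-zero, of order `λ`, then `w·(−1)^λ = 1`.  Proof: at the cyclotomic
pair `(ψ_ζ, ψ_ζ⁻¹)`, `P = (0, ζ−1)`, `(0, ζ⁻¹−1)`, `ζ` a `p^N`-th root of unity with `‖ζ−1‖^λ` beyond
all `‖[T^n]G(0,T)‖`, `n < λ`: leading terms give `‖1 − w(−1)^λ η‖ < 1`, `η ∈ μ_{p^∞}`, `‖η − 1‖ < 1`,
so `w(−1)^λ ≠ −1` (`‖2‖ = 1`). [cite: deShalit1987, II.6.4 (9), (15) and II.6.5 (18) (p. 84–86)]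
[cite: MazurTateTeitelbaum1986Invent, §I.18] -/
theorem sign_mul_neg_one_pow_order_eq_one_of_selfDual (hp2 : p ≠ 2)
    {κ₁ κ₂ : ZpExtension K p} {γ₁ γ₂ : absoluteGaloisGroup K}
    (hpair : ZpExtension.IsTopGeneratorPair κ₁ κ₂ γ₁ γ₂) (hcyc : κ₂.IsCyclotomic)
    (G : PowerSeries (PowerSeries (PadicComplexInt p))) {w : ℂ_[p]} (hw : w = 1 ∨ w = -1)
    (g : absoluteGaloisGroup K)
    (hSD : ∀ (r r₂ : FramedGaloisRep K (PadicAlgCl p) 1),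
      FactorsThroughPair κ₁ κ₂ r → FactorsThroughPair κ₁ κ₂ r₂ → IsConjInverse r r₂ →
      ∀ x : ℂ_[p],
        IntSeries.HasValueAt₂ G (avatarValueAt r₂ γ₁ - 1) (avatarValueAt r₂ γ₂ - 1) x →
        IntSeries.HasValueAt₂ G (avatarValueAt r γ₁ - 1) (avatarValueAt r γ₂ - 1)
          (w * avatarValueAt r g * x))
    (hg : PowerSeries.map (IsLocalRing.residue (PadicComplexInt p)) (PowerSeries.constantCoeff G) ≠ 0) :
    w * (-1) ^ (PowerSeries.map (IsLocalRing.residue (PadicComplexInt p))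
      (PowerSeries.constantCoeff G)).order.toNat = 1 := by
  -- notation: `Q = G(0,·)`, `ḡ` its reduction, `λ = ord ḡ`, coefficients `q n`
  set Q : PowerSeries (PadicComplexInt p) := PowerSeries.constantCoeff G with hQ
  set gbar := PowerSeries.map (IsLocalRing.residue (PadicComplexInt p)) Q with hgbar
  set lam : ℕ := gbar.order.toNat with hlam
  let q : ℕ → ℂ_[p] := fun n => ((PowerSeries.coeff n Q : PadicComplexInt p) : ℂ_[p])
  have hcoef : ∀ n, PowerSeries.coeff n gbar = IsLocalRing.residue _ (PowerSeries.coeff n Q) := fun n ↦ by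
    rw [hgbar, PowerSeries.coeff_map]
  -- `q λ` is a unit, `q n` is not for `n < λ`
  have hqlam : ‖q lam‖ = 1 := by
    have h := PowerSeries.coeff_order hg
    rw [hcoef, ne_eq, IsLocalRing.residue_eq_zero_iff, IsLocalRing.mem_maximalIdeal, mem_nonunits_iff,
      not_not, isUnit_padicComplexInt_iff] at h
    exact h
  have hqlt : ∀ n < lam, ‖q n‖ < 1 := by
    intro n hn
    have h := PowerSeries.coeff_of_lt_order_toNat n hn
    rw [hcoef, IsLocalRing.residue_eq_zero_iff, IsLocalRing.mem_maximalIdeal, mem_nonunits_iff,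
      isUnit_padicComplexInt_iff] at h
    exact lt_of_le_of_ne (norm_coe_padicComplexInt_le_one _) h
  -- a bound `B < 1` for the lower coefficients, and `M < 1` with `M^λ ≥ B`-control
  obtain ⟨B, hB0, hB1, hB⟩ : ∃ B : ℝ, 0 ≤ B ∧ B < 1 ∧ ∀ n < lam, ‖q n‖ ≤ B := by
    refine ⟨((Finset.range lam).sup fun n => ‖q n‖₊ : NNReal), NNReal.coe_nonneg _, ?_, fun n hn => ?_⟩
    · have : ((Finset.range lam).sup fun n => ‖q n‖₊) < 1 := by
        refine (Finset.sup_lt_iff one_pos).mpr fun n hn => ?_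
        have := hqlt n (Finset.mem_range.mp hn)
        exact_mod_cast this
      exact_mod_cast this
    · have h := Finset.le_sup (f := fun n => ‖q n‖₊) (Finset.mem_range.mpr hn)
      exact_mod_cast h
  -- `M := B^{1/(λ+1)}` works uniformly: `M^{λ+1} = B`, and we ask `‖ζ−1‖ > M`
  set M : ℝ := B ^ ((lam + 1 : ℕ) : ℝ)⁻¹ with hM
  have hM1 : M < 1 := by
    rw [hM]
    exact Real.rpow_lt_one hB0 hB1 (by positivity)
  obtain ⟨N, ζ, hζN, hζM, hζ1, hζpow⟩ := exists_rootOfUnity_norm_sub_one_gt (p := p) M hM1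
  -- the cyclotomic pair `(ψ_ζ, ψ_ζ⁻¹)`
  obtain ⟨ψ, hψ⟩ := exists_unitsChar_zmodPow κ₂ N ζ hζN
  have hψker : ∀ σ, κ₂ σ = 1 → ψ σ = 1 := fun σ hσ ↦ unitsChar_zmodPow_eq_one hψ hσ
  have hψker' : ∀ σ, κ₂ σ = 1 → ψ⁻¹ σ = 1 := fun σ hσ ↦ by
    rw [unitsChar_inv_apply, hψker σ hσ, inv_one]
  set e := (FramedRep.unitsContinuousMulEquivOfUnique (Fin 1) (PadicAlgCl p) :
      (PadicAlgCl p)ˣ →ₜ* GL (Fin 1) (PadicAlgCl p)) with he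
  have hr : FactorsThroughPair κ₁ κ₂ (e.comp ψ) :=
    (factorsThroughZp_unitsChar_of_eq_one hψker).factorsThroughPair_right κ₁
  have hr₂ : FactorsThroughPair κ₁ κ₂ (e.comp ψ⁻¹) :=
    (factorsThroughZp_unitsChar_of_eq_one hψker').factorsThroughPair_right κ₁
  have hci : IsConjInverse (e.comp ψ) (e.comp ψ⁻¹) := isConjInverse_unitsChar_inv_of_isCyclotomic hcyc hψker
  -- the evaluation points: `(0, ζ − 1)` and `(0, ζ⁻¹ − 1)`
  set z : ℂ_[p] := (((ζ : PadicAlgCl p)) : ℂ_[p]) with hz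
  set x : ℂ_[p] := z - 1 with hx
  have hM0 : 0 ≤ M := by rw [hM]; positivity
  have hxpos : 0 < ‖x‖ := hM0.trans_lt hζM
  have hN0 : N ≠ 0 := by
    rintro rfl
    rw [pow_zero, pow_one] at hζN
    have : x = 0 := by rw [hx, hz, hζN, Units.val_one, UniformSpace.Completion.coe_one, sub_self]
    rw [this, norm_zero] at hxpos
    exact lt_irrefl _ hxpos
  have hγ₁ : κ₂ γ₁ = 1 := ZpExtension.mem_kerSubgroup.mp hpair.2.1
  have hγ₂ : κ₂ γ₂ = Multiplicative.ofAdd 1 := hpair.2.2.2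
  have hP1 : avatarValueAt (e.comp ψ) γ₁ = 1 := by
    rw [he, avatarValueAt_unitsChar, hψker γ₁ hγ₁, Units.val_one, UniformSpace.Completion.coe_one]
  have hP1' : avatarValueAt (e.comp ψ⁻¹) γ₁ = 1 := by
    rw [he, avatarValueAt_unitsChar, hψker' γ₁ hγ₁, Units.val_one, UniformSpace.Completion.coe_one]
  have hP2 : avatarValueAt (e.comp ψ) γ₂ = z := by
    rw [he, avatarValueAt_unitsChar, unitsChar_zmodPow_apply_of_eq_one hN0 hψ hγ₂]
  have hz0 : z ≠ 0 := by
    intro h0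
    have : ‖x‖ = 1 := by rw [hx, h0, zero_sub, norm_neg, norm_one]
    rw [this] at hζ1
    exact lt_irrefl _ hζ1
  have hP2' : avatarValueAt (e.comp ψ⁻¹) γ₂ = z⁻¹ := by
    rw [he, avatarValueAt_unitsChar, unitsChar_inv_apply, unitsChar_zmodPow_apply_of_eq_one hN0 hψ hγ₂,
      Units.val_inv_eq_inv_val, hz, PadicComplex.coe_eq, PadicComplex.coe_eq, map_inv₀]
  -- norms: `‖z‖ = 1`, `x = z − 1`, `x' = z⁻¹ − 1 = −z⁻¹ x`
  have hz1 : ‖z‖ = 1 := by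
    have : z ^ p ^ N = 1 := by
      rw [hz, PadicComplex.coe_eq, ← map_pow, ← Units.val_pow_eq_pow_val, hζN, Units.val_one, map_one]
    exact norm_eq_one_of_pow_eq_one (pow_ne_zero _ hp.out.ne_zero) this
  have hxlt : ‖x‖ < 1 := hζ1
  have hx' : z⁻¹ - 1 = -z⁻¹ * x := by rw [hx]; field_simp; ring
  have hxn' : ‖z⁻¹ - 1‖ = ‖x‖ := by rw [hx', norm_mul, norm_neg, norm_inv, hz1, inv_one, one_mul]
  -- values of `Q` at `x` and `x'`
  obtain ⟨v, hv⟩ := exists_hasValueAt Q hxlt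
  obtain ⟨v', hv'⟩ := exists_hasValueAt Q (x := z⁻¹ - 1) (by rw [hxn']; exact hxlt)
  -- the relation: `v = w · ψ(g) · v'`
  have hrel := hSD _ _ hr hr₂ hci v'
  rw [hP1, hP1', hP2, hP2', sub_self, IntSeries.hasValueAt₂_zero_left_iff,
    IntSeries.hasValueAt₂_zero_left_iff] at hrel
  have hvv : v = w * avatarValueAt (e.comp ψ) g * v' := hv.unique (hrel hv')
  -- `ψ(g) = ζ^m`, a `1`-unit
  obtain ⟨m, hm⟩ := exists_unitsChar_zmodPow_eq_pow hψ g
  have hug : avatarValueAt (e.comp ψ) g = z ^ m := by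
    rw [he, avatarValueAt_unitsChar, hm, Units.val_pow_eq_pow_val, hz]
    exact map_pow (algebraMap (PadicAlgCl p) ℂ_[p]) _ _
  -- leading-term estimates
  have hB' : ∀ n < lam, ‖((PowerSeries.coeff n Q : PadicComplexInt p) : ℂ_[p])‖ ≤ B := hB
  have hE := norm_value_sub_coeff_mul_pow_le hxlt hv lam hB0 hB'
  have hE' := norm_value_sub_coeff_mul_pow_le (by rw [hxn']; exact hxlt) hv' lam hB0 hB'
  rw [hxn'] at hE'
  -- `max B ‖x‖^{λ+1} < ‖x‖^λ`
  have hmax : max B (‖x‖ ^ (lam + 1)) < ‖x‖ ^ lam := by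
    refine max_lt ?_ ?_
    · -- `B = M^{λ+1} < ‖x‖^{λ+1} ≤ ‖x‖^λ`
      have hMB : M ^ (lam + 1) = B := by
        rw [hM, ← Real.rpow_natCast, ← Real.rpow_mul hB0, inv_mul_cancel₀ (by positivity),
          Real.rpow_one]
      calc B = M ^ (lam + 1) := hMB.symm
        _ < ‖x‖ ^ (lam + 1) := pow_lt_pow_left₀ hζM hM0 (by omega)
        _ ≤ ‖x‖ ^ lam := pow_le_pow_of_le_one hxpos.le hxlt.le (by omega)
    · exact pow_lt_pow_right_of_lt_one₀ hxpos hxlt (by omega)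
  -- combine: `q λ x^λ (1 − w (−1)^λ z^m z^{-λ}) = (w z^m) E' − E`
  set s : ℂ_[p] := w * (-1) ^ lam with hs
  have hs1 : ‖s‖ = 1 := by
    rw [hs, norm_mul, norm_pow, norm_neg, norm_one, one_pow, mul_one]
    rcases hw with h | h <;> simp [h]
  -- `η = z^m · (z⁻¹)^λ` is a `1`-unit
  set η : ℂ_[p] := z ^ m * (z⁻¹) ^ lam with hη
  have hη1 : ‖η - 1‖ < 1 := by
    -- `η = z^{m + (p^N - 1) λ}`-type power of `z`: use `z⁻¹ = z^(p^N - 1)`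
    have hzinv : z⁻¹ = z ^ (p ^ N - 1) := by
      have hzp : z ^ p ^ N = 1 := by
        rw [hz, PadicComplex.coe_eq, ← map_pow, ← Units.val_pow_eq_pow_val, hζN, Units.val_one, map_one]
      have h1 : 1 ≤ p ^ N := Nat.one_le_pow _ _ hp.out.pos
      have hmul : z * z ^ (p ^ N - 1) = 1 := by rw [← pow_succ', Nat.sub_add_cancel h1, hzp]
      exact inv_eq_of_mul_eq_one_right hmul
    rw [hη, hzinv, ← pow_mul, ← pow_add]
    exact (hζpow _).trans_lt hζ1
  have hkey : ‖(q lam * x ^ lam) * (1 - s * η)‖ < ‖x‖ ^ lam := by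
    have hxl : (z⁻¹ - 1) ^ lam = (-1) ^ lam * (z⁻¹) ^ lam * x ^ lam := by rw [hx']; ring
    have e1 : (q lam * x ^ lam) * (1 - s * η) =
        (w * z ^ m) * (v' - q lam * (z⁻¹ - 1) ^ lam) - (v - q lam * x ^ lam) := by
      rw [hxl, hs, hη, hvv, hug]; ring
    have hsub : ∀ a b : ℂ_[p], ‖a - b‖ ≤ max ‖a‖ ‖b‖ := fun a b => by
      rw [sub_eq_add_neg, ← norm_neg b]; exact IsUltrametricDist.norm_add_le_max a (-b)
    rw [e1]
    refine (hsub _ _).trans_lt (max_lt ?_ ?_)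
    · rw [norm_mul, norm_mul, norm_pow, hz1, one_pow, mul_one]
      have hw1 : ‖w‖ = 1 := by rcases hw with h | h <;> simp [h]
      rw [hw1, one_mul]
      exact hE'.trans_lt hmax
    · exact hE.trans_lt hmax
  have hlt1 : ‖1 - s * η‖ < 1 := by
    rw [norm_mul, norm_mul, hqlam, one_mul, norm_pow] at hkey
    exact (mul_lt_iff_lt_one_right (pow_pos hxpos _)).mp hkey
  -- conclude: `s = 1`
  have hs_cases : s = 1 ∨ s = -1 := by
    rcases hw with h | h <;> rcases Nat.even_or_odd lam with hl | hl <;>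
      simp [hs, h, hl.neg_one_pow]
  rcases hs_cases with h1 | hm1
  · exact h1
  · exfalso
    -- `‖1 + η‖ = ‖2 − (1 − η)‖ = 1`
    rw [hm1, neg_one_mul, sub_neg_eq_add] at hlt1
    have : ‖(1 : ℂ_[p]) + η‖ = 1 := by
      have e2 : (1 : ℂ_[p]) + η = 2 + (η - 1) := by ring
      rw [e2, IsUltrametricDist.norm_add_eq_max_of_norm_ne_norm (by rw [norm_two_eq_one hp2]; exact hη1.ne'),
        norm_two_eq_one hp2, max_eq_left hη1.le]
    exact (lt_irrefl _) (this ▸ hlt1)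

/-- **Corollary: `w = (−1)^{λ̄}`.** [cite: deShalit1987, II.6.5 (18) (p. 86)] -/
theorem sign_eq_neg_one_pow_order_of_selfDual (hp2 : p ≠ 2)
    {κ₁ κ₂ : ZpExtension K p} {γ₁ γ₂ : absoluteGaloisGroup K}
    (hpair : ZpExtension.IsTopGeneratorPair κ₁ κ₂ γ₁ γ₂) (hcyc : κ₂.IsCyclotomic)
    (G : PowerSeries (PowerSeries (PadicComplexInt p))) {w : ℂ_[p]} (hw : w = 1 ∨ w = -1)
    (g : absoluteGaloisGroup K)
    (hSD : ∀ (r r₂ : FramedGaloisRep K (PadicAlgCl p) 1),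
      FactorsThroughPair κ₁ κ₂ r → FactorsThroughPair κ₁ κ₂ r₂ → IsConjInverse r r₂ →
      ∀ x : ℂ_[p],
        IntSeries.HasValueAt₂ G (avatarValueAt r₂ γ₁ - 1) (avatarValueAt r₂ γ₂ - 1) x →
        IntSeries.HasValueAt₂ G (avatarValueAt r γ₁ - 1) (avatarValueAt r γ₂ - 1)
          (w * avatarValueAt r g * x))
    (hg : PowerSeries.map (IsLocalRing.residue (PadicComplexInt p)) (PowerSeries.constantCoeff G) ≠ 0) :
    w = (-1) ^ (PowerSeries.map (IsLocalRing.residue (PadicComplexInt p))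
      (PowerSeries.constantCoeff G)).order.toNat := by
  have h := sign_mul_neg_one_pow_order_eq_one_of_selfDual hp2 hpair hcyc G hw g hSD hg
  have hsq : ((-1 : ℂ_[p]) ^ (PowerSeries.map (IsLocalRing.residue (PadicComplexInt p))
      (PowerSeries.constantCoeff G)).order.toNat) ^ 2 = 1 := by
    rw [← pow_mul, mul_comm, pow_mul]; simp
  calc w = w * ((-1 : ℂ_[p]) ^ _ * (-1) ^ _) := by rw [← sq, hsq, mul_one]
    _ = (w * (-1) ^ _) * (-1) ^ _ := by rw [mul_assoc]
    _ = _ := by rw [h, one_mul]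

end Summit.BirchSwinnertonDyer.BirchSwinnertonDyer.Theorems.CycTangentCMCycTangentBoundFrameSignParity

end
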